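import Literature.Probability.Percolation.SlabRSWGluingGeometry
import Literature.Probability.Percolation.SlabGluingFact2
import Literature.Probability.Percolation.HarrisLocal
import HarnessLib

/-!
# Newman–Tassion–Wu 2017, §3.2 — the gluing lemma for slabs, positive-probability (linear) regime

Topic: `Literature/Probability/Percolation`. Sixth file of the port of §3 of Newman–Tassion–Wu,
*Critical percolation and the minimal spanning tree in slabs* (CPAM 70 (2017); arXiv:1512.09107).
The "second part" of the proof of the main gluing lemma (Thm. 3.7; Remark 3 after it: "`h₀` can
be chosen such that `h₀(x) ≥ c₀ x`"): a map `Φ : 𝒳 → 𝒳′` changing boundedly many edges in a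
window that can be read off the image, and the combinatorial Lemma 3.5 (the tree's `lemma7_bond`,
DST's Lemma 7) give `P[𝒳] ≤ C₃ P[𝒳′]`. Here, in the rectangle geometry of
`SlabRSWGluingGeometry.lean` (`S = R = [a,b] × [c,d]`, `B` the full right side, `A, C ⊆ S` far
apart), with the three local modifications of `exists_gadget`:

* `real_evXn_le` — PROVED: `P_p[𝒳] ≤ λ^s · P_p[C ⟷^S A]`, `λ = 2/min{p, 1-p}`,
  `s = 3·(5k+4)·(12ρ+9)²` (the window: the lattice edges touching the columns within sup-distance
  `6ρ + 4` of a point of one of the three recovery statistics).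
* `real_evAB_inter_evNear_le` — PROVED: `P_p[A ⟷^S B, C̄ ⟷^{S̄} 𝒩(Γ̄, ρ)] ≤ (1 + λ^s) P_p[C ⟷^S A]`
  (Thm. 3.7 with `h₀(x) = x/(1 + λ^s)`, `R = S`).
* `glueLinear` — PROVED: **GL0 in the linear regime** (Thm. 3.6 with `h₀` linear): under NTW's
  planar-crossing hypothesis for `(A, B, C, D)`,
  `P_p[C ⟷^S A] ≥ (1 + λ^s)⁻¹ · P_p[A ⟷^S B] · P_p[C ⟷^S D]` (Harris–FKG for the last step).

## Sources

* C. M. Newman, V. Tassion, W. Wu, *Critical percolation and the minimal spanning tree in slabs*,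
  Comm. Pure Appl. Math. 70 (2017), arXiv:1512.09107: §3.2, Lemma 3.5, Theorems 3.6–3.7, proof of
  Theorem 3.7 ("For the second part, we claim that for all `x ∈ [0,1]`, one can take
  `h₂(x) = c₀ x` …", p. 10) and proof of Theorem 3.6 (p. 10) [NewmanTassionWu2017].

## Design choices

* Only `0 < p < 1` (the statement is used for `p ∈ [ε, 1 - ε]`); the constant is explicit but not
  optimised. The high-probability regime (Facts 1–2) is a separate file.
-/

noncomputable section

namespace Literature.Probability.Percolation

open MeasureTheory LatticeModels SimpleGraph Finset

namespace NTW17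

variable {k : ℕ}

/-! ## Windows: new configurations consist of old edges and lattice edges inside `R̄` -/

section Window

/-- The new configuration of a surgery: old edges, or lattice edges inside `R̄`.
[cite: NewmanTassionWu2017, §3.2 (proof of Theorem 3.7, "the number of edges … that can vary is bounded")] -/
theorem GlueData.Surgery.mem_window {Q : GlueData} {ω : BondConfig (slab 3 k)} (sx : Q.Surgery k ω)
    (hA : ω ∈ Q.evAB k) {e : Sym2 (slab 3 k)} (he : e ∈ sx.newConfig) :
    e ∈ ω ∨ (e ∈ (slabGraph 3 k).edgeSet ∧ e ∈ (slabLift k Q.R).sym2) := by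
  rcases sx.newConfig_subset hA he with h | h
  · exact Or.inl h
  · right
    refine ⟨?_, ?_⟩
    · rcases h with h | h
      · exact edgesOf_subset_edgeSet sx.hSPchain h
      · exact edgesOf_subset_edgeSet sx.hBchain h
    · induction e using Sym2.ind with
      | h a b =>
        obtain ⟨ha, hb⟩ := sx.structEdges_Sw h
        have aux : ∀ x ∈ sx.Sw, x ∈ slabLift k Q.R := by
          rintro x (hx | rfl)
          · exact sx.hDR (sx.Wv_D hx)
          · exact slabLift_mono k (fun _ h => h.1) sx.q₁_mem
        exact Set.mk_mem_sym2_iff.2 ⟨aux a ha, aux b hb⟩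

/-- The new configuration of a direct gluing: old edges, or lattice edges inside `R̄`.
[cite: NewmanTassionWu2017, §3.2 (proof of Theorem 3.7, "the number of edges … that can vary is bounded")] -/
theorem DirectGlue.mem_window {R Src Tg : Set (ℤ × ℤ)} {ω : BondConfig (slab 3 k)}
    (dg : DirectGlue k R Src Tg ω) {e : Sym2 (slab 3 k)} (he : e ∈ dg.newConfig) :
    e ∈ ω ∨ (e ∈ (slabGraph 3 k).edgeSet ∧ e ∈ (slabLift k R).sym2) := by
  rcases he with h | h
  · exact Or.inl h.1
  · right
    refine ⟨edgesOf_subset_edgeSet dg.hchain h, ?_⟩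
    induction e using Sym2.ind with
    | h a b =>
      obtain ⟨ha, hb⟩ := mem_of_mem_edgesOf h
      have aux : ∀ x ∈ dg.q₁ :: dg.L, x ∈ slabLift k R := by
        intro x hx
        rcases List.mem_cons.1 hx with rfl | hx
        · exact slabLift_mono k (fun _ h => h.1) dg.q₁_mem
        · exact dg.hDR (dg.hLD x hx)
      exact Set.mk_mem_sym2_iff.2 ⟨aux a ha, aux b hb⟩

end Window

/-! ## The events are determined by the edges inside `R̄` -/

section Congr

variable {Q : GlueData} {ω ω' : BondConfig (slab 3 k)}

/-- Congruence of `X ⟷^B Y` for configurations agreeing inside `T̄ ⊇ B̄`. [cite: NewmanTassionWu2017, §3.2 (the event A ↔^S B)] -/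
theorem mem_slabConn_congr' {B T X Y : Set (ℤ × ℤ)}
    (h : ∀ e ∈ (slabLift k T).sym2, e ∈ ω ↔ e ∈ ω') (hB : B ⊆ T) :
    ω ∈ slabConn k B X Y ↔ ω' ∈ slabConn k B X Y := by
  have hd := determinedBy_slabConn k X Y hB
  rw [determinedBy_iff] at hd
  exact hd ω ω' (Set.ext fun e => ⟨fun he => ⟨(h e he.2).1 he.1, he.2⟩, fun he => ⟨(h e he.2).2 he.1, he.2⟩⟩)

/-- `Γ` is determined by the edges inside `R̄`. [cite: NewmanTassionWu2017, §3.2 (definition of Γ_min)] -/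
theorem GlueData.γ_congr (h : ∀ e ∈ (slabLift k Q.R).sym2, e ∈ ω ↔ e ∈ ω') : Q.γ k ω = Q.γ k ω' :=
  minPath_congr Q.S_finite fun e he => h e (sym2_mono (slabLift_mono k Q.hSR) he)

/-- `𝒳` is determined by the edges inside `R̄`. [cite: NewmanTassionWu2017, §3.2 (proof of Theorem 3.7, the event 𝒳)] -/
theorem GlueData.mem_evXn_congr {ρ : ℕ} (h : ∀ e ∈ (slabLift k Q.R).sym2, e ∈ ω ↔ e ∈ ω') :
    ω ∈ Q.evXn k ρ ↔ ω' ∈ Q.evXn k ρ := by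
  simp only [GlueData.evXn, GlueData.evX, GlueData.evAB, GlueData.evCA, GlueData.evNear,
    Set.mem_inter_iff, Set.mem_compl_iff, Set.mem_setOf_eq]
  rw [mem_slabConn_congr' h Q.hSR, mem_slabConn_congr' h subset_rfl, Q.γ_congr h]
  simp only [openConnIn_congr h]

end Congr

/-! ## The chosen local modification -/

section Gadget

variable (T : RectSetup) (k) (ρ : ℕ)

/-- The new configuration of the chosen local modification of `ω` (a rerouting surgery if one
exists with a small cleared box, else a direct gluing near `A`, else one near `C`; `ω` itself if
none exists). [cite: NewmanTassionWu2017, §3.2 (proof of Theorem 3.7, the map Φ : 𝒳 → 𝔓(𝒳′))] -/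
def gadgetConfig (ω : BondConfig (slab 3 k)) : BondConfig (slab 3 k) :=
  open scoped Classical in
  if h : ∃ sx : T.Q.Surgery k ω, ∃ z : ℤ × ℤ, sx.D ⊆ sqBox z (3 * ρ + 2) then
    (Classical.choose h).newConfig
  else if h : ∃ dg : DirectGlue k T.S T.C T.A ω, ∃ z : ℤ × ℤ, dg.D ⊆ sqBox z (3 * ρ + 2) then
    (Classical.choose h).newConfig
  else if h : ∃ dg : DirectGlue k T.S T.A T.C ω, ∃ z : ℤ × ℤ, dg.D ⊆ sqBox z (3 * ρ + 2) then
    (Classical.choose h).newConfig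
  else ω

variable {T k ρ}

/-- The three possible shapes of the chosen modification on `𝒳`.
[cite: NewmanTassionWu2017, §3.2 (proof of Theorem 3.7, the map Φ)] -/
theorem gadgetConfig_cases (hk : 1 ≤ k) (hρ : 2 ≤ ρ)
    (hsep : ∀ a' ∈ T.A, ∀ c' ∈ T.C, c' ∉ sqBox a' (4 * ρ + 8)) {ω : BondConfig (slab 3 k)}
    (hω : ω ⊆ (slabGraph 3 k).edgeSet) (hX : ω ∈ T.Q.evXn k ρ) :
    (∃ sx : T.Q.Surgery k ω, gadgetConfig k T ρ ω = sx.newConfig ∧ ∃ z : ℤ × ℤ, sx.D ⊆ sqBox z (3 * ρ + 2)) ∨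
    (∃ dg : DirectGlue k T.S T.C T.A ω, gadgetConfig k T ρ ω = dg.newConfig ∧
      ∃ z : ℤ × ℤ, dg.D ⊆ sqBox z (3 * ρ + 2)) ∨
    (∃ dg : DirectGlue k T.S T.A T.C ω, gadgetConfig k T ρ ω = dg.newConfig ∧
      ∃ z : ℤ × ℤ, dg.D ⊆ sqBox z (3 * ρ + 2)) := by
  classical
  unfold gadgetConfig
  by_cases h1 : ∃ sx : T.Q.Surgery k ω, ∃ z : ℤ × ℤ, sx.D ⊆ sqBox z (3 * ρ + 2)
  · rw [dif_pos h1]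
    exact Or.inl ⟨_, rfl, Classical.choose_spec h1⟩
  rw [dif_neg h1]
  by_cases h2 : ∃ dg : DirectGlue k T.S T.C T.A ω, ∃ z : ℤ × ℤ, dg.D ⊆ sqBox z (3 * ρ + 2)
  · rw [dif_pos h2]
    exact Or.inr (Or.inl ⟨_, rfl, Classical.choose_spec h2⟩)
  rw [dif_neg h2]
  by_cases h3 : ∃ dg : DirectGlue k T.S T.A T.C ω, ∃ z : ℤ × ℤ, dg.D ⊆ sqBox z (3 * ρ + 2)
  · rw [dif_pos h3]
    exact Or.inr (Or.inr ⟨_, rfl, Classical.choose_spec h3⟩)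
  exfalso
  rcases exists_gadget hk hρ hsep hω hX with h | h | h
  · exact h1 h
  · exact h2 h
  · exact h3 h

/-- The chosen modification glues `C` to `A`. [cite: NewmanTassionWu2017, §3.2 (proof of Theorem 3.7, "By construction, ω^{(z)} ∈ 𝒳′")] -/
theorem gadgetConfig_mem_evCA (hk : 1 ≤ k) (hρ : 2 ≤ ρ)
    (hsep : ∀ a' ∈ T.A, ∀ c' ∈ T.C, c' ∉ sqBox a' (4 * ρ + 8)) {ω : BondConfig (slab 3 k)}
    (hω : ω ⊆ (slabGraph 3 k).edgeSet) (hX : ω ∈ T.Q.evXn k ρ) :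
    gadgetConfig k T ρ ω ∈ T.Q.evCA k := by
  have hX' : ω ∈ T.Q.evX k := hX.1
  have hnCA : ω ∉ slabConn k T.S T.C T.A := hX'.2
  have hnAC : ω ∉ slabConn k T.S T.A T.C := fun h => hnCA (slabConn_comm h)
  rcases gadgetConfig_cases hk hρ hsep hω hX with ⟨sx, h, -⟩ | ⟨dg, h, -⟩ | ⟨dg, h, -⟩
  · rw [h]; exact sx.newConfig_mem_evCA hX'
  · rw [h]; exact dg.newConfig_mem hnCA
  · rw [h]; exact slabConn_comm (dg.newConfig_mem hnAC)

/-- The chosen modification stays inside the window. [cite: NewmanTassionWu2017, §3.2 (proof of Theorem 3.7)] -/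
theorem gadgetConfig_window (hk : 1 ≤ k) (hρ : 2 ≤ ρ)
    (hsep : ∀ a' ∈ T.A, ∀ c' ∈ T.C, c' ∉ sqBox a' (4 * ρ + 8)) {ω : BondConfig (slab 3 k)}
    (hω : ω ⊆ (slabGraph 3 k).edgeSet) (hX : ω ∈ T.Q.evXn k ρ) {e : Sym2 (slab 3 k)}
    (he : e ∈ gadgetConfig k T ρ ω) :
    e ∈ ω ∨ (e ∈ (slabGraph 3 k).edgeSet ∧ e ∈ (slabLift k T.S).sym2) := by
  rcases gadgetConfig_cases hk hρ hsep hω hX with ⟨sx, h, -⟩ | ⟨dg, h, -⟩ | ⟨dg, h, -⟩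
  · rw [h] at he; exact sx.mem_window hX.1.1 he
  · rw [h] at he; exact dg.mem_window he
  · rw [h] at he; exact dg.mem_window he

end Gadget

/-! ## Counting the window -/

section Counting

/-- A box of radius `r` around `z` lies in the box of radius `2r` around any of its points.
[cite: NewmanTassionWu2017, §2.3 (Notation, dist*)] -/
theorem sqBox_subset_double {z q : ℤ × ℤ} {r : ℕ} (hq : q ∈ sqBox z r) : sqBox z r ⊆ sqBox q (2 * r) := by
  intro w hw
  have := mem_sqBox_add (GlueGeom.mem_sqBox_comm hq) hw
  simpa [two_mul] using this

end Counting

/-! ## The linear bound -/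

section Bound

variable {T : RectSetup} {ρ : ℕ}

/-- **NTW 2017, proof of Thm. 3.7, second part: `P[𝒳] ≤ C₃ · P[C ⟷^S A]`** in the rectangle
geometry with `B` the full right side and `A, C ⊆ S` at sup-distance `> 4ρ + 8`: the map
`ω ↦ {gadgetConfig ω}` changes only edges touching the columns within `6ρ + 4` of a point of one
of the three recovery statistics of the image, so Lemma 3.5 (`lemma7_bond`, `t = 1`) applies
with `s = 3·(5k+4)·(12ρ+9)²`. [cite: NewmanTassionWu2017, §3.2 (proof of Theorem 3.7, second part, P[𝒳] ≤ C₃ P[𝒳′])] -/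
theorem real_evXn_le (hk : 1 ≤ k) (hρ : 2 ≤ ρ)
    (hsep : ∀ a' ∈ T.A, ∀ c' ∈ T.C, c' ∉ sqBox a' (4 * ρ + 8))
    (p : unitInterval) (hp0 : 0 < (p : ℝ)) (hp1 : (p : ℝ) < 1) :
    (bondPercolation (slabGraph 3 k) p).real (T.Q.evXn k ρ) ≤
      (2 / min (p : ℝ) (1 - p)) ^ (3 * ((5 * k + 4) * (2 * (6 * ρ + 4) + 1) ^ 2)) *
        (bondPercolation (slabGraph 3 k) p).real (T.Q.evCA k) := by
  classical
  set P := bondPercolation (slabGraph 3 k) p with hP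
  set r : ℕ := 3 * ρ + 2 with hr
  -- the window
  have hRfin : (slabLift k T.S).Finite := slabLift_finite k (boxR_finite _ _ _ _)
  set K' : Finset (Sym2 (slab 3 k)) := (finite_sym2 hRfin).toFinset with hK'def
  have hK'coe : (↑K' : Set (Sym2 (slab 3 k))) = (slabLift k T.S).sym2 := Set.Finite.coe_toFinset _
  set Kfin : Finset (Sym2 (slab 3 k)) := K'.filter (· ∈ (slabGraph 3 k).edgeSet) with hKfin
  have hK : ∀ e, e ∈ Kfin ↔ e ∈ K' ∧ e ∈ (slabGraph 3 k).edgeSet := fun e => Finset.mem_filter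
  have hKE : ∀ e ∈ Kfin, e ∈ (slabGraph 3 k).edgeSet := fun e he => ((hK e).1 he).2
  have hagree : ∀ ω ω' : BondConfig (slab 3 k), ω ∩ ↑K' = ω' ∩ ↑K' →
      ∀ e ∈ (slabLift k T.S).sym2, e ∈ ω ↔ e ∈ ω' := by
    intro ω ω' heq e he
    rw [← hK'coe] at he
    have := Set.ext_iff.1 heq e
    simp only [Set.mem_inter_iff, he, and_true] at this
    exact this
  have hA : DeterminedBy (T.Q.evXn k ρ) ↑K' := by
    rw [determinedBy_iff]
    intro ω ω' heq
    exact GlueData.mem_evXn_congr (hagree ω ω' heq)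
  have hB : DeterminedBy (T.Q.evCA k) ↑K' := by
    rw [determinedBy_iff]
    intro ω ω' heq
    exact mem_slabConn_congr' (hagree ω ω' heq) subset_rfl
  -- lattice configurations inside the window
  have hlat : ∀ S : Finset (Sym2 (slab 3 k)), S ⊆ Kfin →
      (↑S : Set (Sym2 (slab 3 k))) ⊆ (slabGraph 3 k).edgeSet := fun S hS e he => hKE e (hS he)
  have hnewK : ∀ S : Finset (Sym2 (slab 3 k)), S ⊆ Kfin → (↑S : BondConfig (slab 3 k)) ∈ T.Q.evXn k ρ →
      gadgetConfig k T ρ (↑S) ⊆ ↑Kfin := by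
    intro S hS hSX e he
    rcases gadgetConfig_window hk hρ hsep (hlat S hS) hSX he with h | ⟨h1, h2⟩
    · exact hS h
    · rw [Finset.mem_coe, hK]
      exact ⟨by rw [← Finset.mem_coe, hK'coe]; exact h2, h1⟩
  have hcoe : ∀ S : Finset (Sym2 (slab 3 k)), S ⊆ Kfin → (↑S : BondConfig (slab 3 k)) ∈ T.Q.evXn k ρ →
      (↑(Kfin.filter (· ∈ gadgetConfig k T ρ ↑S)) : Set (Sym2 (slab 3 k))) = gadgetConfig k T ρ ↑S := by
    intro S hS hSX
    ext e
    simp only [Finset.coe_filter, Set.mem_setOf_eq, and_iff_right_iff_imp]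
    exact fun he => hnewK S hS hSX he
  -- the (single-valued) map
  set Φ : Finset (Sym2 (slab 3 k)) → Finset (Finset (Sym2 (slab 3 k))) := fun S =>
    {Kfin.filter (· ∈ gadgetConfig k T ρ ↑S)} with hΦ
  set lam : ℝ := 2 / min (p : ℝ) (1 - p) with hlam
  set s₀ : ℕ := (5 * k + 4) * (2 * (6 * ρ + 4) + 1) ^ 2 with hs₀
  set s : ℕ := 3 * s₀ with hs
  -- the window around a vertex
  let box : slab 3 k → Finset (Sym2 (slab 3 k)) := fun q₀ =>
    Kfin.filter fun e => ∃ u ∈ e, planar k u ∈ (sqBox_finite (planar k q₀) (6 * ρ + 4)).toFinset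
  have hbox_card : ∀ q₀, (box q₀).card ≤ s₀ := by
    intro q₀
    refine (card_filter_colEdges_le k Kfin hKE _).trans ?_
    have := card_toFinset_sqBox_le (planar k q₀) (6 * ρ + 4)
    rw [hs₀]; exact Nat.mul_le_mul_left _ this
  -- agreement off the window, for a cleared set inside the box
  have hbox_agree : ∀ (S S' : Finset (Sym2 (slab 3 k))) (D : Set (ℤ × ℤ)) (q₀ : slab 3 k),
      S ⊆ Kfin → S' ⊆ Kfin → planar k q₀ ∈ D → (∃ z : ℤ × ℤ, D ⊆ sqBox z r) →
      (∀ e, e ∉ touch k D → (e ∈ (↑S : BondConfig (slab 3 k)) ↔ e ∈ (↑S' : BondConfig (slab 3 k)))) →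
      ∀ e, e ∉ box q₀ → (e ∈ S ↔ e ∈ S') := by
    intro S S' D q₀ hS hS' hq₀D hz hag e heT
    obtain ⟨z, hDz⟩ := hz
    have hDq : D ⊆ sqBox (planar k q₀) (6 * ρ + 4) := by
      have h1 := sqBox_subset_double (hDz hq₀D)
      rw [show 2 * r = 6 * ρ + 4 by omega] at h1
      exact hDz.trans h1
    by_cases heK : e ∈ Kfin
    · have hnt : e ∉ touch k D := by
        rintro ⟨x, hx, hxD⟩
        exact heT (Finset.mem_filter.2 ⟨heK, x, hx, (Set.Finite.mem_toFinset _).2 (hDq hxD)⟩)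
      have := hag e hnt
      simp only [Finset.mem_coe] at this
      exact this
    · constructor
      · intro heS; exact absurd (hS heS) heK
      · intro heS'; exact absurd (hS' heS') heK
  have hmain := lemma7_bond (slabGraph 3 k) p hp0 hp1 K' Kfin hK hA hB s zero_lt_one Φ ?_ ?_ ?_
  · calc P.real (T.Q.evXn k ρ) ≤ lam ^ s / 1 * P.real (T.Q.evCA k) := hmain
      _ = lam ^ s * P.real (T.Q.evCA k) := by rw [div_one]
  · -- the image glues `C` to `A`
    intro S hS hSA S' hS'
    have hS'eq : S' = Kfin.filter (· ∈ gadgetConfig k T ρ ↑S) := by simpa [hΦ] using hS'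
    subst hS'eq
    refine ⟨Finset.filter_subset _ _, ?_⟩
    rw [hcoe S hS hSA]
    exact gadgetConfig_mem_evCA hk hρ hsep (hlat S hS) hSA
  · -- one image
    intro S _ _
    simp [hΦ]
  · -- recovery window
    intro S' hS' _
    set ω' : BondConfig (slab 3 k) := ↑S' with hω'
    -- one window per statistic
    set T₁ : Finset (Sym2 (slab 3 k)) :=
      if h : (T.Q.att k ω').Nonempty then box h.some else ∅ with hT₁
    set T₂ : Finset (Sym2 (slab 3 k)) :=
      if h : (attT k T.S T.C T.A ω').Nonempty then box h.some else ∅ with hT₂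
    set T₃ : Finset (Sym2 (slab 3 k)) :=
      if h : (attT k T.S T.A T.C ω').Nonempty then box h.some else ∅ with hT₃
    have hT₁c : T₁.card ≤ s₀ := by rw [hT₁]; split_ifs <;> simp [hbox_card]
    have hT₂c : T₂.card ≤ s₀ := by rw [hT₂]; split_ifs <;> simp [hbox_card]
    have hT₃c : T₃.card ≤ s₀ := by rw [hT₃]; split_ifs <;> simp [hbox_card]
    refine ⟨T₁ ∪ T₂ ∪ T₃, ?_, ?_⟩
    · calc (T₁ ∪ T₂ ∪ T₃).card ≤ (T₁ ∪ T₂).card + T₃.card := Finset.card_union_le _ _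
        _ ≤ (T₁.card + T₂.card) + T₃.card := by gcongr; exact Finset.card_union_le _ _
        _ ≤ s₀ + s₀ + s₀ := by omega
        _ = s := by rw [hs]; ring
    · intro S hS hSA hmem e heT
      replace hmem : S' = Kfin.filter (· ∈ gadgetConfig k T ρ ↑S) := by simpa [hΦ] using hmem
      have hωS : (↑S : Set (Sym2 (slab 3 k))) ⊆ (slabGraph 3 k).edgeSet := hlat S hS
      have hX' : (↑S : BondConfig (slab 3 k)) ∈ T.Q.evX k := hSA.1
      have hω'eq : ω' = gadgetConfig k T ρ ↑S := by rw [hω', hmem, hcoe S hS hSA]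
      simp only [Finset.mem_union, not_or] at heT
      obtain ⟨⟨heT₁, heT₂⟩, heT₃⟩ := heT
      rcases gadgetConfig_cases hk hρ hsep hωS hSA with ⟨sx, hsx, hz⟩ | ⟨dg, hdg, hz⟩ | ⟨dg, hdg, hz⟩
      · -- a rerouting surgery: recover through `att`
        have hne : (T.Q.att k ω').Nonempty := by
          rw [hω'eq, hsx]; exact sx.att_nonempty hX'
        have hT₁' : T₁ = box hne.some := by rw [hT₁, dif_pos hne]
        have hq₀ : hne.some ∈ T.Q.att k sx.newConfig := by
          rw [← hsx, ← hω'eq]; exact hne.some_mem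
        have hq₀D : planar k hne.some ∈ sx.D := by
          have := sx.att_subset hX' hq₀; rwa [mem_slabLift_iff] at this
        refine hbox_agree S S' sx.D hne.some hS hS' hq₀D hz (fun e' he' => ?_) e (hT₁' ▸ heT₁)
        rw [show ((↑S' : BondConfig (slab 3 k))) = sx.newConfig from hω' ▸ hω'eq.trans hsx]
        exact sx.agree_off_touch he'
      · -- a direct gluing near `A`: recover through `attT (C, A)`
        have hnCA : (↑S : BondConfig (slab 3 k)) ∉ slabConn k T.S T.C T.A := hX'.2
        have hne : (attT k T.S T.C T.A ω').Nonempty := by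
          rw [hω'eq, hdg]; exact dg.attT_nonempty hnCA
        have hT₂' : T₂ = box hne.some := by rw [hT₂, dif_pos hne]
        have hq₀ : hne.some ∈ attT k T.S T.C T.A dg.newConfig := by
          rw [← hdg, ← hω'eq]; exact hne.some_mem
        have hq₀D : planar k hne.some ∈ dg.D := by
          have := dg.attT_subset hnCA hq₀; rwa [mem_slabLift_iff] at this
        refine hbox_agree S S' dg.D hne.some hS hS' hq₀D hz (fun e' he' => ?_) e (hT₂' ▸ heT₂)
        rw [show ((↑S' : BondConfig (slab 3 k))) = dg.newConfig from hω' ▸ hω'eq.trans hdg]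
        exact dg.agree_off_touch he'
      · -- a direct gluing near `C`: recover through `attT (A, C)`
        have hnAC : (↑S : BondConfig (slab 3 k)) ∉ slabConn k T.S T.A T.C :=
          fun h => hX'.2 (slabConn_comm h)
        have hne : (attT k T.S T.A T.C ω').Nonempty := by
          rw [hω'eq, hdg]; exact dg.attT_nonempty hnAC
        have hT₃' : T₃ = box hne.some := by rw [hT₃, dif_pos hne]
        have hq₀ : hne.some ∈ attT k T.S T.A T.C dg.newConfig := by
          rw [← hdg, ← hω'eq]; exact hne.some_mem
        have hq₀D : planar k hne.some ∈ dg.D := by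
          have := dg.attT_subset hnAC hq₀; rwa [mem_slabLift_iff] at this
        refine hbox_agree S S' dg.D hne.some hS hS' hq₀D hz (fun e' he' => ?_) e (hT₃' ▸ heT₃)
        rw [show ((↑S' : BondConfig (slab 3 k))) = dg.newConfig from hω' ▸ hω'eq.trans hdg]
        exact dg.agree_off_touch he'

/-- **NTW 2017, Thm. 3.7 in the linear regime, `R = S` a rectangle, `B` the full right side**:
`P_p[A ⟷^S B, C̄ ⟷^{S̄} 𝒩(Γ̄, ρ)] ≤ (1 + λ^s) · P_p[C ⟷^S A]`.
[cite: NewmanTassionWu2017, §3.2 (Theorem 3.7 with Remark 3, h₀(x) ≥ c₀ x)] -/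
theorem real_evAB_inter_evNear_le (hk : 1 ≤ k) (hρ : 2 ≤ ρ)
    (hsep : ∀ a' ∈ T.A, ∀ c' ∈ T.C, c' ∉ sqBox a' (4 * ρ + 8))
    (p : unitInterval) (hp0 : 0 < (p : ℝ)) (hp1 : (p : ℝ) < 1) :
    (bondPercolation (slabGraph 3 k) p).real (T.Q.evAB k ∩ T.Q.evNear k ρ) ≤
      (1 + (2 / min (p : ℝ) (1 - p)) ^ (3 * ((5 * k + 4) * (2 * (6 * ρ + 4) + 1) ^ 2))) *
        (bondPercolation (slabGraph 3 k) p).real (T.Q.evCA k) := by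
  set P := bondPercolation (slabGraph 3 k) p with hP
  have hsub : T.Q.evAB k ∩ T.Q.evNear k ρ ⊆ T.Q.evXn k ρ ∪ T.Q.evCA k := by
    intro ω ⟨hAB, hN⟩
    by_cases hCA : ω ∈ T.Q.evCA k
    · exact Or.inr hCA
    · exact Or.inl ⟨⟨hAB, hCA⟩, hN⟩
  have h1 := real_evXn_le hk hρ hsep p hp0 hp1
  calc P.real (T.Q.evAB k ∩ T.Q.evNear k ρ) ≤ P.real (T.Q.evXn k ρ ∪ T.Q.evCA k) :=
        measureReal_mono hsub
    _ ≤ P.real (T.Q.evXn k ρ) + P.real (T.Q.evCA k) := measureReal_union_le _ _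
    _ ≤ _ := by rw [add_mul, one_mul, add_comm]; gcongr

end Bound

/-! ## GL0 in the linear regime -/

section GL0

variable (k)

/-- Planar walks: consecutive cells equal or adjacent (the projection of a lattice path of the
slab). [cite: NewmanTassionWu2017, §3.2 (Theorem 3.6, "the projection on ℤ² of any path")] -/
def IsPlanarWalk (l : List (ℤ × ℤ)) : Prop := l.IsChain (fun z w => z = w ∨ planarAdj z w)

/-- **NTW's planar-crossing hypothesis of GL0**: inside `S`, the projection of any path from `A`
to `B` meets the projection of any path from `C` to `D`.
[cite: NewmanTassionWu2017, §3.2 (Theorem 3.6, hypothesis on A, B, C, D)] -/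
def PlanarCrossing (S A B C D : Set (ℤ × ℤ)) : Prop :=
  ∀ (l₁ l₂ : List (ℤ × ℤ)) (h₁ : l₁ ≠ []) (h₂ : l₂ ≠ []), IsPlanarWalk l₁ → IsPlanarWalk l₂ →
    (∀ z ∈ l₁, z ∈ S) → (∀ z ∈ l₂, z ∈ S) → l₁.head h₁ ∈ A → l₁.getLast h₁ ∈ B →
    l₂.head h₂ ∈ C → l₂.getLast h₂ ∈ D → ∃ z ∈ l₁, z ∈ l₂

variable {k}

/-- The projection of an open path of a lattice configuration is a planar walk.
[cite: NewmanTassionWu2017, §3.2 (Theorem 3.6, "the projection on ℤ² of any path")] -/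
theorem isPlanarWalk_map_planar {ω : BondConfig (slab 3 k)} (hω : ω ⊆ (slabGraph 3 k).edgeSet)
    {l : List (slab 3 k)} (hl : l.IsChain (fun a b => s(a, b) ∈ ω ∧ a ≠ b)) :
    IsPlanarWalk (l.map (planar k)) := by
  rw [IsPlanarWalk, List.isChain_map]
  refine hl.imp fun a b h => ?_
  have hadj : (slabGraph 3 k).Adj a b := (SimpleGraph.mem_edgeSet _).1 (hω h.1)
  rcases (slab_adj_iff a b).1 hadj with ⟨-, hp⟩ | ⟨hp, -⟩
  · exact Or.inr hp
  · exact Or.inl hp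

variable {T : RectSetup} {ρ : ℕ}

/-- Under the planar-crossing hypothesis, `A ⟷^S B` and `C ⟷^S D` force a contact at distance `0`:
`{A ⟷ B} ∩ {C ⟷ D} ⊆ {C̄ ⟷ 𝒩(Γ̄, ρ)}` up to a null set (lattice configurations).
[cite: NewmanTassionWu2017, §3.2 (proof of Theorem 3.6, "{A ↔ B, C ↔ D} implies {C ↔ Γ̄}")] -/
theorem mem_evNear_of_cross {Dd : Set (ℤ × ℤ)} (hcross : PlanarCrossing T.S T.A T.B T.C Dd)
    {ω : BondConfig (slab 3 k)} (hω : ω ⊆ (slabGraph 3 k).edgeSet) (hAB : ω ∈ T.Q.evAB k)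
    (hCD : ω ∈ slabConn k T.S T.C Dd) : ω ∈ T.Q.evNear k ρ := by
  obtain ⟨hγO, -⟩ := T.Q.γ_spec hAB
  obtain ⟨L, hL⟩ := (mem_slabConn_iff_exists_isOSAP ω _ _ _).1 hCD
  set γ := T.Q.γ k ω with hγdef
  have hw₁ := isPlanarWalk_map_planar hω hγO.chain
  have hw₂ := isPlanarWalk_map_planar hω hL.chain
  have hne₁ : γ.map (planar k) ≠ [] := by simpa using hγO.ne_nil
  have hne₂ : L.map (planar k) ≠ [] := by simpa using hL.ne_nil
  have hhead₁ : (γ.map (planar k)).head hne₁ ∈ T.A := by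
    rw [List.head_map]; exact hγO.head_mem hγO.ne_nil
  have hlast₁ : (γ.map (planar k)).getLast hne₁ ∈ T.B := by
    rw [List.getLast_map]; exact hγO.last_mem hγO.ne_nil
  have hhead₂ : (L.map (planar k)).head hne₂ ∈ T.C := by
    rw [List.head_map]; exact hL.head_mem hL.ne_nil
  have hlast₂ : (L.map (planar k)).getLast hne₂ ∈ Dd := by
    rw [List.getLast_map]; exact hL.last_mem hL.ne_nil
  obtain ⟨z, hz₁, hz₂⟩ := hcross _ _ hne₁ hne₂ hw₁ hw₂
    (fun z hz => by obtain ⟨g, hg, rfl⟩ := List.mem_map.1 hz; exact hγO.subset g hg)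
    (fun z hz => by obtain ⟨x, hx, rfl⟩ := List.mem_map.1 hz; exact hL.subset x hx)
    hhead₁ hlast₁ hhead₂ hlast₂
  obtain ⟨g, hg, hgz⟩ := List.mem_map.1 hz₁
  obtain ⟨x, hx, hxz⟩ := List.mem_map.1 hz₂
  refine ⟨L.head hL.ne_nil, hL.head_mem hL.ne_nil, x, hL.openConnIn_of_mem hx, g, hg, ?_⟩
  rw [hxz, ← hgz]
  exact sqBox_mono _ (Nat.zero_le ρ) (mem_sqBox_self _ _)

/-- **NTW 2017, Theorem 3.6 (GL0) in the linear regime** — in a rectangle `S = [a,b] × [c,d]`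
of the slab `S_k` (`k ≥ 1`), with `B` the full right side, `A, C ⊆ S` at sup-distance
`> 4ρ + 8` (`ρ ≥ 2`), `D ⊆ S` arbitrary, and the planar-crossing hypothesis for `(A, B, C, D)`:
for `0 < p < 1`,
`P_p[C ⟷^S A] ≥ (1 + λ^s)⁻¹ · P_p[A ⟷^S B] · P_p[C ⟷^S D]`, `λ = 2 / min{p, 1-p}`,
`s = 3(5k+4)(12ρ+9)²` (Harris–FKG for `P[A ⟷ B, C ⟷ D] ≥ P[A ⟷ B] P[C ⟷ D]`).
-- TODO(general form): `B` any boundary segment; rectilinear domains; the high-probability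
regime `h₀(1-δ) → 1` (Facts 1–2). [cite: NewmanTassionWu2017, §3.2 (Theorem 3.6 with Remark 3: h₀(x) ≥ c₀ x)] -/
theorem glueLinear (T : RectSetup) (hk : 1 ≤ k) (hρ : 2 ≤ ρ)
    (hsep : ∀ a' ∈ T.A, ∀ c' ∈ T.C, c' ∉ sqBox a' (4 * ρ + 8)) {Dd : Set (ℤ × ℤ)}
    (hcross : PlanarCrossing T.S T.A T.B T.C Dd)
    (p : unitInterval) (hp0 : 0 < (p : ℝ)) (hp1 : (p : ℝ) < 1) :
    (bondPercolation (slabGraph 3 k) p).real (slabConn k T.S T.A T.B) *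
        (bondPercolation (slabGraph 3 k) p).real (slabConn k T.S T.C Dd) ≤
      (1 + (2 / min (p : ℝ) (1 - p)) ^ (3 * ((5 * k + 4) * (2 * (6 * ρ + 4) + 1) ^ 2))) *
        (bondPercolation (slabGraph 3 k) p).real (slabConn k T.S T.C T.A) := by
  set P := bondPercolation (slabGraph 3 k) p with hP
  have hfin : (slabLift k T.S).sym2.Finite := finite_sym2 (slabLift_finite k (boxR_finite _ _ _ _))
  have hloc : ∀ X Y : Set (ℤ × ℤ), IsLocalEvent (slabConn k T.S X Y) := by
    intro X Y
    refine ⟨hfin.toFinset, ?_⟩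
    rw [Set.Finite.coe_toFinset]
    exact determinedBy_slabConn k X Y subset_rfl
  -- Harris–FKG
  have hH : P.real (slabConn k T.S T.A T.B) * P.real (slabConn k T.S T.C Dd) ≤
      P.real (slabConn k T.S T.A T.B ∩ slabConn k T.S T.C Dd) :=
    harris_fkg_local (slabGraph 3 k) p (isUpperSet_openCrossing _ _ _) (isUpperSet_openCrossing _ _ _)
      (hloc _ _) (hloc _ _)
  -- the intersection forces a contact, almost surely
  have hae : ∀ᵐ ω ∂P, ω ∈ slabConn k T.S T.A T.B ∩ slabConn k T.S T.C Dd →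
      ω ∈ T.Q.evAB k ∩ T.Q.evNear k ρ := by
    filter_upwards [ae_subset_edgeSet (slabGraph 3 k) p] with ω hω
    rintro ⟨hAB, hCD⟩
    exact ⟨hAB, mem_evNear_of_cross hcross hω hAB hCD⟩
  have hmono : P.real (slabConn k T.S T.A T.B ∩ slabConn k T.S T.C Dd) ≤
      P.real (T.Q.evAB k ∩ T.Q.evNear k ρ) := by
    simp only [measureReal_def]
    exact ENNReal.toReal_mono (measure_ne_top _ _) (measure_mono_ae hae)
  exact hH.trans (hmono.trans (real_evAB_inter_evNear_le hk hρ hsep p hp0 hp1))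

end GL0

end NTW17

end Literature.Probability.Percolation
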